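import Summits.QuantumFields.QCD.Theorems.ExtinctionBuildsQCD.Negative.WithoutTightCollapse

/-!
# Negative knowledge for the RESTATED crux `WindowExtinction` = SD⁺ (stmt-QuantumFields-18063):
# the near-tip band — EXTINCT, the scalings, the volume cap and the branch clause are decoration;
# all junk-excluding content of SD⁺ is TIGHT⁺ under the cap

Refuter crux-attack seat `refuter-rattack-stmt-QuantumFields-18063-0`, 2026-08-17 (one-shot; verdict: the crux
survives).  Supports stmt-QuantumFields-18063; asserts NO route item (the only statements about the route decl
`WindowExtinction` are projections FROM it).  Pure theorem file (no definitions): it reuses the route-independent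
§1–§2 material of `ExtinctionBuildsQCD/Negative/WithoutTightCollapse.lean` (`Extinct` = the EXTINCT clause verbatim,
unchanged by the restate; `countP_signDefect_eq_zero`, `countP_coercivityDefect_eq_zero`, `extinct_of_mcrit_nonneg`).
CAVEAT for the operator: that module's §0 (`windowExtinction_iff`, `extinctionBuildsQCD_iff`, proved `Iff.rfl` against the
PRE-restate bodies) no longer compiles against the regenerated route file (rev 9, 2026-08-17T00:03Z) and needs repair;
nothing below uses §0.

* §1 **The near-tip band.** For `0 ≤ c ≤ 1`, `0 ≤ M₀` and ANY step with `m_crit(k) ≥ -(1-c)·a_k M₀/Z_k`, the EXTINCT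
  integrand vanishes for every gauge field on every torus (`defectCount_eq_zero_of_band`), so EXTINCT holds with no
  scaling / coupling / volume input (`extinct_of_band`).  The band contains `m_crit ≡ 0` (`extinct_of_mcrit_nonneg`)
  AND lines tending to `0⁻` at the rate `a_k/Z_k` ("physical-looking").
* §2 **SD⁺ minus TIGHT⁺ is junk-inhabited WITH the 2026-08-17 repair clauses.** `canonicalAF` (`m_crit ≡ 0`) meets the
  polynomial volume cap with exponent `p = 2` (`L_k = a_k⁻²`, `canonicalAF_cap`) and the branch clause, hence realises
  "scalings ∧ CAP ∧ BRANCH ∧ ∃ M₀ c, ∀ m > M₀, EXTINCT" for every `N_f` (`sdPlus_without_tightPlus_inhabited`); so does a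
  near-tip line `m_crit(k) = -min((1-c) a_k M₀/Z_k, 1/2)` (on the branch at EVERY step) with the GIVEN threshold `M₀` and
  window constant `c` (`exists_nearTip_witness`).  `WindowExtinction` projects onto exactly this junk-inhabited statement
  once TIGHT⁺ is dropped (`windowExtinction_content`).  Reading for planners/provers: neither BRANCH, nor a sign clause
  `m_crit < 0`, nor `m_crit → 0⁻` makes EXTINCT contentful; the entire junk-excluding content of SD⁺ is TIGHT⁺ evaluated
  under the cap (R1 ∧ R2); a depth clause leaving the band (refuters' R4 `c₀ ≤ -m_crit(k) β_k`, or R3) is the next repair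
  should a capped junk family for TIGHT⁺ ever appear.  (TIGHT⁺ projects onto the old pin `1 ≤ ratio` by `le_max_left`, so
  every landed consequence of TIGHT — e.g. `TipPricing/Negative/TightPins.mcrit_le_window_of_tight` — transfers to SD⁺.)

References: Montvay–Münster 1994 §4.1/§5.1 (Wilson positivity, critical line); Hernández–Jansen–Lüscher NPB 552 (1999)
363, (2.14); Edwards–Heller–Narayanan NPB 535 (1998) 403 (spectral flow of `γ₅ D_W`).
-/

noncomputable section

namespace Summit.QuantumFields.QCD.Theorems.WindowExtinction.Negative.NearTipBand

open scoped BigOperators Topology Classical MeasureTheory Matrix ComplexConjugate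
open Filter MeasureTheory Matrix
open Literature.MathematicalPhysics.QuantumLattice Literature.MathematicalPhysics.QuantumFieldTheory
  Literature.Probability.LatticeModels
open Summit.QuantumFields.QCD.Theses.SpectralDefectExtinction
open Summit.QuantumFields.QCD.Theorems.ExtinctionBuildsQCD.Negative

variable {Nf : ℕ}

/-! ## §1 The near-tip band: EXTINCT is decoration for `m_crit(k) ≥ -(1-c) a_k M₀ / Z_k` -/

/-- **EXTINCT is decoration on the whole near-tip band, not only at `m_crit ≥ 0`.**
If `0 ≤ c ≤ 1`, `0 ≤ M₀` and the line satisfies `m_crit(k) ≥ -(1-c)·a_k M₀/Z_k` at step `k`, then for every mass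
tuple `m > M₀` the EXTINCT integrand vanishes for EVERY gauge field on EVERY torus: the sign-defect threshold
`-(m_crit + a m_f/Z)` is `≤ 0` (no real eigenvalue of `D_W(U,0,1)` below it, Wilson positivity) and the coercivity
window `c·a m_f/Z` is `≤` the bare mass `m_crit + a m_f/Z` (every eigenvalue of `Γ₅ D_W(U,μ,1)` has modulus `≥ μ`). -/
theorem defectCount_eq_zero_of_band (reg : QCDRegularisation Nf) {k : ℕ} {c M₀ : ℝ}
    (hc0 : 0 ≤ c) (hc1 : c ≤ 1) (hM₀ : 0 ≤ M₀)
    (hband : -((1 - c) * (reg.a k * M₀ / reg.Zm k)) ≤ reg.mcrit k)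
    (m : Fin Nf → ℝ) (hm : ∀ f, M₀ < m f) {S : ℕ} [NeZero S] (U : GaugeConfig 4 S SU3) :
    (∑ f : Fin Nf, ((Multiset.countP (fun z : ℂ => z.im = 0 ∧ z.re < -(reg.mcrit k + reg.a k * m f / reg.Zm k)) (wilsonDirac (fundamentalRep (Fin 3)) U 0 1).charpoly.roots : ℝ) + (Multiset.countP (fun z : ℂ => |z.re| < c * (reg.a k * m f / reg.Zm k)) (spinorLift gammaFive * wilsonDirac (fundamentalRep (Fin 3)) U (reg.mcrit k + reg.a k * m f / reg.Zm k) 1).charpoly.roots : ℝ))) = 0 := by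
  refine Finset.sum_eq_zero fun f _ => ?_
  have haZ : 0 < reg.a k / reg.Zm k := div_pos (reg.a_pos k) (reg.Zm_pos k)
  have hmf : M₀ < m f := hm f
  have e1 : reg.a k * M₀ / reg.Zm k = (reg.a k / reg.Zm k) * M₀ := by ring
  have e2 : reg.a k * m f / reg.Zm k = (reg.a k / reg.Zm k) * m f := by ring
  have hw : reg.a k * M₀ / reg.Zm k < reg.a k * m f / reg.Zm k := by
    rw [e1, e2]; exact mul_lt_mul_of_pos_left hmf haZ
  have hw0 : 0 ≤ reg.a k * M₀ / reg.Zm k := by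
    rw [e1]; exact mul_nonneg haZ.le hM₀
  have h1c : 0 ≤ 1 - c := by linarith
  have hthr : -(reg.mcrit k + reg.a k * m f / reg.Zm k) ≤ 0 := by
    have : (1 - c) * (reg.a k * M₀ / reg.Zm k) ≤ reg.a k * M₀ / reg.Zm k := by nlinarith
    linarith
  have hcw : c * (reg.a k * m f / reg.Zm k) ≤ reg.mcrit k + reg.a k * m f / reg.Zm k := by
    have : (1 - c) * (reg.a k * M₀ / reg.Zm k) ≤ (1 - c) * (reg.a k * m f / reg.Zm k) :=
      mul_le_mul_of_nonneg_left hw.le h1c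
    linarith
  rw [countP_signDefect_eq_zero U hthr, countP_coercivityDefect_eq_zero U hcw, Nat.cast_zero, add_zero]

/-- Hence the EXTINCT clause of SD⁺ (`Extinct`, verbatim) holds for such a line with NO scaling, coupling, cap
or volume hypothesis: its numerator is `∫ 0 = 0 ≤ ε · ratio⁴`. -/
theorem extinct_of_band (reg : QCDRegularisation Nf) {c M₀ : ℝ}
    (hc0 : 0 ≤ c) (hc1 : c ≤ 1) (hM₀ : 0 ≤ M₀)
    (hband : ∀ k, -((1 - c) * (reg.a k * M₀ / reg.Zm k)) ≤ reg.mcrit k)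
    (m : Fin Nf → ℝ) (hm : ∀ f, M₀ < m f) : Extinct Nf reg c m := by
  intro ε hε
  refine Filter.Eventually.of_forall fun k S _ => ?_
  simp only [defectCount_eq_zero_of_band reg hc0 hc1 hM₀ (hband k) m hm, zero_mul, integral_zero,
    zero_div]
  positivity

/-! ## §2 SD⁺ minus TIGHT⁺ is junk-inhabited, cap and branch included -/

/-- `canonicalAF` meets the polynomial volume cap with exponent `p = 2` (indeed `L_k = a_k⁻²`). -/
theorem canonicalAF_cap :
    ∀ᶠ k : ℕ in Filter.atTop, ((QCDRegularisation.canonicalAF Nf).L k : ℝ) ≤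
      ((QCDRegularisation.canonicalAF Nf).a k)⁻¹ ^ 2 := by
  refine Filter.Eventually.of_forall fun k => le_of_eq ?_
  simp [QCDRegularisation.canonicalAF, QCDScheme.zeroAF, SpeciesScheme.zero]

variable (Nf) in
/-- **Without TIGHT⁺ the restated crux is trivial**: the body of SD⁺ at flavour number `N_f` with the TIGHT⁺
conjunct deleted (scalings, polynomial volume cap, branch clause, threshold, window constant, EXTINCT — verbatim)
is realised by the tip regularisation `canonicalAF` (`m_crit ≡ 0`, cap exponent `2`), with `M₀ = 0`, `c = 1`,
for EVERY `N_f`. -/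
theorem sdPlus_without_tightPlus_inhabited :
    ∃ reg : QCDRegularisation Nf, reg.HasMassScaling ∧ (reg.scheme 0 0 0).HasAsymptoticScaling ∧
      (∃ p : ℕ, ∀ᶠ k : ℕ in Filter.atTop, (reg.L k : ℝ) ≤ (reg.a k)⁻¹ ^ p) ∧
      (∀ᶠ k : ℕ in Filter.atTop, -1 < reg.mcrit k) ∧
      ∃ M₀ : ℝ, 0 ≤ M₀ ∧ ∃ c : ℝ, 0 < c ∧ ∀ m : Fin Nf → ℝ, (∀ f, M₀ < m f) → Extinct Nf reg c m :=
  ⟨QCDRegularisation.canonicalAF Nf, QCDRegularisation.canonicalAF_hasMassScaling,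
    QCDScheme.zeroAF_hasAsymptoticScaling, ⟨2, canonicalAF_cap⟩,
    Filter.Eventually.of_forall fun _ => by norm_num [QCDRegularisation.canonicalAF],
    0, le_rfl, 1, one_pos, fun m hm => extinct_of_mcrit_nonneg _ (fun _ => le_rfl) le_rfl m hm⟩

/-- **A near-tip line tending to `0⁻` does no better.** For `0 < c ≤ 1` and `0 ≤ M₀` there is a regularisation
with line `m_crit(k) = -min((1-c)·a_k M₀/Z_k, 1/2)` (→ `0⁻`, "physical-looking"; `canonicalAF` otherwise) which is
mass-scaling, asymptotically scaling, capped with `p = 2`, on the branch at EVERY step, and EXTINCT at every mass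
tuple `m > M₀` with the GIVEN window constant `c` — so neither a sign clause `m_crit < 0` nor `m_crit → 0⁻` would make
EXTINCT contentful; only a depth clause leaving the band (`|m_crit(k)| ≫ a_k/Z_k`) could. -/
theorem exists_nearTip_witness {c M₀ : ℝ} (hc0 : 0 < c) (hc1 : c ≤ 1) (hM₀ : 0 ≤ M₀) :
    ∃ reg : QCDRegularisation Nf,
      (∀ k, reg.mcrit k = -min ((1 - c) * (reg.a k * M₀ / reg.Zm k)) (1 / 2)) ∧
      reg.HasMassScaling ∧ (reg.scheme 0 0 0).HasAsymptoticScaling ∧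
      (∀ᶠ k : ℕ in Filter.atTop, (reg.L k : ℝ) ≤ (reg.a k)⁻¹ ^ 2) ∧
      (∀ k, -1 < reg.mcrit k) ∧
      ∀ m : Fin Nf → ℝ, (∀ f, M₀ < m f) → Extinct Nf reg c m := by
  let can := QCDRegularisation.canonicalAF Nf
  let reg : QCDRegularisation Nf :=
    { can with mcrit := fun k => -min ((1 - c) * (can.a k * M₀ / can.Zm k)) (1 / 2) }
  have hband : ∀ k, -((1 - c) * (reg.a k * M₀ / reg.Zm k)) ≤ reg.mcrit k :=
    fun k => neg_le_neg (min_le_left _ _)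
  have hbranch : ∀ k, -1 < reg.mcrit k := fun k => by
    have h : min ((1 - c) * (can.a k * M₀ / can.Zm k)) (1 / 2) ≤ 1 / 2 := min_le_right _ _
    show -1 < -min _ _
    linarith
  exact ⟨reg, fun _ => rfl, QCDRegularisation.canonicalAF_hasMassScaling, QCDScheme.zeroAF_hasAsymptoticScaling,
    canonicalAF_cap (Nf := Nf), hbranch, fun m hm => extinct_of_band reg hc0.le hc1 hM₀ hband m hm⟩

/-- **Load-bearing map of the restated crux.** `WindowExtinction` (SD⁺) projects, once TIGHT⁺ is dropped, onto
the statement of `sdPlus_without_tightPlus_inhabited` — which holds for junk reasons; so every bit of content that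
separates an honest witness from the tip family sits in TIGHT⁺ evaluated under the volume cap.  (The destructuring
also certifies that `Extinct` and the clause order are verbatim the regenerated route text.) -/
theorem windowExtinction_content :
    (WindowExtinction → ∀ Nf : ℕ, (Nf = 2 ∨ Nf = 3) →
      ∃ reg : QCDRegularisation Nf, reg.HasMassScaling ∧ (reg.scheme 0 0 0).HasAsymptoticScaling ∧
        (∃ p : ℕ, ∀ᶠ k : ℕ in Filter.atTop, (reg.L k : ℝ) ≤ (reg.a k)⁻¹ ^ p) ∧
        (∀ᶠ k : ℕ in Filter.atTop, -1 < reg.mcrit k) ∧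
        ∃ M₀ : ℝ, 0 ≤ M₀ ∧ ∃ c : ℝ, 0 < c ∧ ∀ m : Fin Nf → ℝ, (∀ f, M₀ < m f) → Extinct Nf reg c m) ∧
    (∀ Nf : ℕ,
      ∃ reg : QCDRegularisation Nf, reg.HasMassScaling ∧ (reg.scheme 0 0 0).HasAsymptoticScaling ∧
        (∃ p : ℕ, ∀ᶠ k : ℕ in Filter.atTop, (reg.L k : ℝ) ≤ (reg.a k)⁻¹ ^ p) ∧
        (∀ᶠ k : ℕ in Filter.atTop, -1 < reg.mcrit k) ∧
        ∃ M₀ : ℝ, 0 ≤ M₀ ∧ ∃ c : ℝ, 0 < c ∧ ∀ m : Fin Nf → ℝ, (∀ f, M₀ < m f) → Extinct Nf reg c m) := by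
  refine ⟨fun h Nf hNf => ?_, fun Nf => sdPlus_without_tightPlus_inhabited Nf⟩
  obtain ⟨reg, h1, h2, h3, h4, M₀, hM₀, c, hc, h⟩ := h Nf hNf
  exact ⟨reg, h1, h2, h3, h4, M₀, hM₀, c, hc, fun m hm => (h m hm).1⟩

/-- **TIGHT⁺ projects onto the old pin.** Any SD⁺ witness satisfies the pre-restate TIGHT clause (`Tight`,
`1 ≤ ratio`), so the landed consequences of TIGHT (line pinned into the window, `TightPins`) apply to it. -/
theorem tight_of_windowExtinction (h : WindowExtinction) (Nf : ℕ) (hNf : Nf = 2 ∨ Nf = 3) :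
    ∃ reg : QCDRegularisation Nf, (∃ p : ℕ, ∀ᶠ k : ℕ in Filter.atTop, (reg.L k : ℝ) ≤ (reg.a k)⁻¹ ^ p) ∧
      ∃ M₀ : ℝ, 0 ≤ M₀ ∧ ∃ c : ℝ, 0 < c ∧ ∀ m : Fin Nf → ℝ, (∀ f, M₀ < m f) →
        Extinct Nf reg c m ∧ Tight Nf reg M₀ m := by
  obtain ⟨reg, -, -, h3, -, M₀, hM₀, c, hc, h⟩ := h Nf hNf
  refine ⟨reg, h3, M₀, hM₀, c, hc, fun m hm => ⟨(h m hm).1, fun M hM => ?_⟩⟩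
  obtain ⟨η, -, hη⟩ := (h m hm).2
  filter_upwards [hη M hM] with k hk
  exact le_trans (le_max_left _ _) hk

end Summit.QuantumFields.QCD.Theorems.WindowExtinction.Negative.NearTipBand

end
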